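import Summits.KontsevichZagierPeriods.KontsevichZagierPeriods.Theses.LiftingCriteria

/-!
# Route LiftingCriteria — `Assembly` (stmt-KontsevichZagierPeriods-3578)

The assembly of route LiftingCriteria (problem `KontsevichZagierPeriods`):
`CubeNashNormalForm → DilationTransfer → DilationLiftAtOne → KontsevichZagierPeriods`.

Pure bookkeeping over the KZ calculus of moves. Given rational representations `r`, `r'` with the
same value:

1. `CubeNashNormalForm` rewrites `[r] − [r']` modulo `KZ.relations` as a `ℤ`-combination
   `Σ εᵢ [sᵢ]` of cube representations `sᵢ = ∫_{[0,1]^{nᵢ}} gᵢ` with `gᵢ` Nash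
   (`ℚ`-semialgebraic and real-analytic near the closed cube);
2. soundness of the calculus (`KZ.relations_le_ker_eval_holds`, proved in Literature) and
   `value r = value r'` give the numerical relation `Σ εᵢ v_{gᵢ}(1) = 0`, where
   `v_g(ϖ) = ∫_cube g(ϖ z) dz` is the dilation function, `v_{gᵢ}(1) = value sᵢ`;
3. `DilationLiftAtOne` (with `m = ε`, `m₀ = 0`) lifts it to a functional relation
   `Σ εᵢ v_{gᵢ}(ϖ) = (ϖ − 1)(μ₀(ϖ) + Σ μⱼ(ϖ) v_{Gⱼ}(ϖ))` on `[0,1]`;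
4. `DilationTransfer` at `ϖ₀ = 1` (representations `sᵢ`, the unit representation `u = [pt, 1]` of
   dimension `0`) turns the functional relation into `0 • [u] + Σ εᵢ [sᵢ] ∈ KZ.relations`;
5. hence `[r] − [r'] = ([r] − [r'] − Σ εᵢ [sᵢ]) + Σ εᵢ [sᵢ] ∈ KZ.relations`, i.e.
   `KZ.Equivalent r r'`, which is `KontsevichZagierPeriods` (`KontsevichZagierPeriods_iff`).

This is the same chain as the route's deciding theorem `closes`; it is replayed here in full so
that the item is closed by a self-contained Theorems file. Pure proof file; no definitions, no
named facts. Sources: M. Kontsevich, D. Zagier, *Periods* (2001), §1.2; A. Huber,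
S. Müller-Stach, *Periods and Nori motives* (2017), §13.1 (soundness of the calculus).
-/

noncomputable section

open MeasureTheory Set
open Literature.NumberTheory.Transcendental

namespace Summit.KontsevichZagierPeriods.LiftingCriteria

/-- The unit representation of dimension `0`: the point `Fin 0 → ℝ` (Lebesgue volume `1`) with
integrand `1`; it represents the number `1`. [Kontsevich–Zagier 2001, §1.1] [folklore] -/
theorem exists_unitIntegralRep :
    ∃ u : KZ.IntegralRep 0, u.domain = Set.univ ∧ ∀ x, u.integrand x = 1 := by
  have hvol : MeasureTheory.volume (Set.univ : Set (Fin 0 → ℝ)) = 1 := by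
    rw [MeasureTheory.volume_pi, MeasureTheory.Measure.pi_univ]; simp
  exact ⟨{ domain := Set.univ
           integrand := fun _ => 1
           isSemialgebraic_domain := Literature.ModelTheory.ExponentialFields.isSemialgebraic_univ
           isSemialgebraicFunOn_integrand := by
             simpa using Literature.NumberTheory.Transcendental.isSemialgebraicFunOn_aeval
               (Literature.ModelTheory.ExponentialFields.isSemialgebraic_univ
                 (k := ℚ) (ι := Fin 0) (R := ℝ)) (1 : MvPolynomial (Fin 0) ℚ)
           integrableOn := MeasureTheory.integrableOn_const (hs := by simp [hvol]) },
         rfl, fun _ => rfl⟩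

/-- **Assembly of route LiftingCriteria** (item stmt-KontsevichZagierPeriods-3578):
`CubeNashNormalForm → DilationTransfer → DilationLiftAtOne → KontsevichZagierPeriods`.
Normal form, soundness of the KZ calculus, lift of the numerical relation at `ϖ = 1` to a
functional one in the dilation pencil, transfer of the functional relation back into the
calculus at `ϖ₀ = 1`. [Kontsevich–Zagier 2001, §1.2] [folklore] -/
theorem assembly_proof :
    Summit.KontsevichZagierPeriods.KontsevichZagierPeriods.Theses.LiftingCriteria.Assembly := by
  unfold Summit.KontsevichZagierPeriods.KontsevichZagierPeriods.Theses.LiftingCriteria.Assembly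
  intro hN hT hL k k' r r' hr hr' hval
  -- (1) cube-Nash normal form of [r] − [r']
  obtain ⟨S, n, g, U, ε, s, hg, hs, hrel⟩ := hN k k' r r' hr hr'
  have hcube : ∀ i, MeasurableSet (Set.pi Set.univ (fun _ : Fin (n i) => Set.Icc (0:ℝ) 1)) :=
    fun i => MeasurableSet.univ_pi (fun _ => measurableSet_Icc)
  -- the dilation value at ϖ = 1 of g i is the value of the cube representation s i
  have hsval : ∀ i,
      (∫ z in Set.pi Set.univ (fun _ : Fin (n i) => Set.Icc (0:ℝ) 1), g i ((1:ℝ) • z))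
        = (s i).value := by
    intro i
    simp only [one_smul]
    rw [KZ.IntegralRep.value, (hs i).1]
    exact (MeasureTheory.setIntegral_congr_fun (hcube i) (hs i).2).symm
  -- (2) soundness of the KZ calculus: the normal-form combination evaluates to 0 and
  --     value r = value r', hence Σ ε_i v_{g_i}(1) = 0
  have hker := KZ.relations_le_ker_eval_holds hrel
  simp only [AddMonoidHom.mem_ker, map_sub, map_sum, map_zsmul, KZ.eval_of, zsmul_eq_mul, hval,
    sub_self, zero_sub, neg_eq_zero] at hker
  have hsum : ((0:ℤ) : ℝ) + ∑ i, (ε i : ℝ) *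
      (∫ z in Set.pi Set.univ (fun _ : Fin (n i) => Set.Icc (0:ℝ) 1), g i ((1:ℝ) • z)) = 0 := by
    simp only [hsval, Int.cast_zero, zero_add]
    exact hker
  -- (3) lift the numerical relation at ϖ = 1 to a functional one (m = ε, m₀ = 0)
  obtain ⟨T, d, G, V, μ, μ₀, hG, hμ, hμ₀, hfun⟩ := hL S n g U hg ε 0 hsum
  -- the unit representation [pt, 1] in dimension 0
  obtain ⟨u, hu1, hu2⟩ := exists_unitIntegralRep
  -- (4) transfer the functional relation, specialised at ϖ₀ = 1, into the KZ calculus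
  have hmem := hT S n g U hg ε 0 1 one_pos le_rfl
    ⟨T, d, G, V, μ, μ₀, hG, hμ, hμ₀, fun ϖ hϖ => by rw [Rat.cast_one]; exact hfun ϖ hϖ⟩
    s u (fun i => ⟨(hs i).1, fun z hz => by rw [Rat.cast_one, one_smul]; exact (hs i).2 z hz⟩)
    hu1 hu2
  simp only [zero_smul, zero_add] at hmem
  -- (5) [r] − [r'] = ([r] − [r'] − Σ ε_i [s_i]) + Σ ε_i [s_i] ∈ relations
  have h := add_mem hrel hmem
  rw [sub_add_cancel] at h
  exact h

end Summit.KontsevichZagierPeriods.LiftingCriteria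

end
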